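import Summits.QuantumFields.YangMills.Theorems.BalabanUVNodesN15TwoSpacingGluingCurvedKnitCovariantAveragingJetDefect
import Summits.QuantumFields.YangMills.Theorems.BalabanUVNodesN15TwoSpacingGluingCurvedKnitCovariantAveragingNodeTwo
import HarnessLib

/-!
# THE GLUING STEP AT TWO LATTICE SPACINGS — PROGRAMME (P-Q), XIIIb: NE2⁺ BY NAME FOR THE (P-Q) FAMILY WITH ALL FOUR ENTRIES CONSTRUCTED — entry 0 = the η-defect of the glued propagators
# with Bałaban's covariant averaging summand live (n15-c∕188), entries 1–2 = the flat-jet defects of the same pair (n15-c∕190), entry 3 = the `(ΔG)`-defect (n15-c∕192) — FILE 140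
# `ne2PlusOperator_sf₄`'s twin, `M = L^m` live

Cell `pub-ymgap`, seat `pub-ymgap-dag-n15-c` (R134 (a); HUMAN RULING D-0062), generation 21.  `bears_on: R4∕N15 · K3⁸ SpineGivenEndpointR13SepCoPHV (stmt-QuantumFields-27366)`.
Filed `--supports stmt-QuantumFields-27366 --as helper` — COUNT-NEUTRAL.  ONE theorem; 0 `sorry`.  Imports BY NAME n15-c∕193a (`ne2PlusOperator_sfq₃`), 190 (`sfq_idef_jet_cvGlued`), 189b
(`l2_opNorm_le_frobenius_norm`, `pow_sub_one_le_exp_sub_one`), FILE 132∕133 objects.  FILE 140's reduction with n15-c∕189b's window bookkeeping.  Nothing in the tree is modified.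

★★★ `ne2PlusOperator_sfq₄`: for odd `L ≥ 7`, `a > 0`, `c₃₅ > 0`, trace-form coordinates `e` (operator norms), jet indices `j₁, j₂`: if the consumer's entries are PINNED (equations `hE1`,
`hE2`, `hE3`) to the flat-jet defects `𝔇(∇′_{j}∘glued′, ∇_{j}∘glued)` (`j = j₁, j₂`) and the `(ΔG)`-defect of the (P-Q) glued pair, then
`NE2PlusOperator c₃₅ (sfInstance d mm ι hL) (fun i => sfqFamily d mm ι a e hL i (E i))` — ALL FOUR ENTRIES of (3.42) constructed and proved for the glued propagators of the cover whose
Bałaban summand is `N_L ⊗ 1 − N_V^Q` (covariant block averaging `Q(U)` live), NO displayed row.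

HONEST FRAMING ∕ LIMITS.  MODEL family on MODEL carriers (doubled-torus cover; global small-field gauge `U = e^{ηĀ′}`, `U′ = e^{η′A′}`; `Q(U)` = the main term (125) of [B7] (124), not the full
nonlinear average; the Landau summand `D_UR(U)D*_U` of (3.26) FLAT; flat jets; entrywise (3.42) SHAPES with crude constants); NOT [B9] Thm 3.1∕3.14 as printed and no estimate of Bałaban's.
This is the n15-c road-(c) rider «non-abelian dressing of NE2» for the AVERAGING summand; N15 of record untouched (DISCHARGED AS CONSUMED, p687738); counts UNMOVED (typed 28∕28 ·
discharged 8∕28); one finite 𝕋⁴ at fixed ε per index — NOT infinite volume ∕ OS ∕ mass gap ∕ Clay.  Restate-immune (no Theses import).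
-/

noncomputable section

open scoped BigOperators Matrix

namespace Summit.QuantumFields.YangMills.BalabanUVNodes.N15.Gluing

open Literature.MathematicalPhysics.QuantumFieldTheory.Balaban1983to89
open Literature.MathematicalPhysics.QuantumFieldTheory.Balaban1983to89.B11SectG (BlockNorm HasMaj)
open Literature.MathematicalPhysics.QuantumFieldTheory.Balaban1983to89.T4EtaRate (NE2PlusOperator EtaRateIneq342 rateFactor rateFactor_nonneg)
open Literature.MathematicalPhysics.QuantumFieldTheory.Balaban1983to89.T4EtaRateDefect (idef)
open Literature.MathematicalPhysics.QuantumFieldTheory.Balaban1983to89.T4EtaRateCoeffDefect (pull)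
open Summit.QuantumFields.YangMills.BalabanUVNodes.N15.BackgroundLayer (covLapM gavgM fgrad bgrad)
open Summit.QuantumFields.YangMills.BalabanUVNodes.N15.MatrixSpecies (coordMat liftMap liftEquiv)
open Summit.QuantumFields.YangMills.BalabanUVNodes.N15.CurvedSpecies (gaugePair)
open Literature.Barriers.QuantumFields (traceForm)
open Summit.QuantumFields.YangMills.BalabanUVNodes.N15.VectorPiece (bshiftEquiv kingPrV unitTorusGeoS)
open Summit.QuantumFields.YangMills.BalabanUVNodes.N15.MatrixSpecies (liftBlk basisConst basisConst_nonneg)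
open Summit.QuantumFields.YangMills.BalabanUVNodes.N15.OperatorReadout (opGeo opFamily opGeo_len rateFactor_opGeo etaRateIneq342_of_hasMaj pref4_pos)
open Literature.NumberTheory.Sieve.SquarefreeSums (exp_sub_one_le_two_mul)

variable {d : ℕ} {L : ℕ} [NeZero L]

/-! ## `NE2PlusOperator` by name for the (P-Q) family: all four entries constructed -/

section Node

open scoped Matrix.Norms.L2Operator

variable (d) (mm ι : Type) [Fintype mm] [DecidableEq mm] [Nonempty mm] [Fintype ι] [DecidableEq ι] (e : Matrix mm mm ℂ ≃L[ℝ] (ι → ℝ))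

set_option maxHeartbeats 1600000 in
/-- ★★★ **NE2⁺ BY NAME FOR THE (P-Q) FAMILY, ALL FOUR ENTRIES CONSTRUCTED** (statement in the module docstring).  MODEL family; NOT [B9] Thm 3.1∕3.14 as printed.
[cite: Balaban1985BackgroundPropagators, Thm 3.1 p.397 ((3.42): the four entries), (3.26) p.395, (3.50) p.400, Thm 3.14 pp.426–427 (difference template); Balaban1985Averaging, (124)–(125) p.36; King1986, p.664, Prop. 3.9 (3.73) p.665; Balaban1984PropagatorsII, (2.91)–(2.93) p.239] -/
theorem ne2PlusOperator_sfq₄ (hL : Odd L ∧ 1 < L) (hL7 : 7 ≤ L) {a : ℝ} (ha : 0 < a) {c35 : ℝ} (hc35 : 0 < c35) (he : ∀ A B : Matrix mm mm ℂ, traceForm A B = e A ⬝ᵥ e B)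
    (j₁ j₂ : Fin (d + 1) ⊕ Fin (d + 1))
    (E : ∀ i : SfIdx d L, Fin 4 → (Fin (d + 1) → CvX' d L i.m i.kk i.r hL → Matrix mm mm ℂ) → ((CvX d L i.m i.kk hL × ι → ℝ) →ₗ[ℝ] (CvX' d L i.m i.kk i.r hL × ι → ℝ)))
    (hE1 : ∀ (i : SfIdx d L) (A' : Fin (d + 1) → CvX' d L i.m i.kk i.r hL → Matrix mm mm ℂ), E i 1 A' =
      idef (pull (liftMap (kingPrV L i.kk i.r (cvM d L i.m i.kk hL)) ι)) (pull (liftMap (kingPrV L i.kk i.r (cvM d L i.m i.kk hL)) ι))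
            (Sum.elim (fun μ => fgrad (((((L ^ i.r * L ^ i.kk : ℕ) : ℝ))⁻¹))⁻¹ (liftEquiv (bshiftEquiv (cvM d L i.m i.kk hL) (L ^ i.r * L ^ i.kk) μ) ι)) (fun μ => bgrad (((((L ^ i.r * L ^ i.kk : ℕ) : ℝ))⁻¹))⁻¹ (liftEquiv (bshiftEquiv (cvM d L i.m i.kk hL) (L ^ i.r * L ^ i.kk) μ) ι)) j₁ ∘ₗ
              cvGlued' d L i.m i.kk i.r hL a ((((L ^ i.r * L ^ i.kk : ℕ) : ℝ))⁻¹) ι e (fun _ _ => (1 : Matrix mm mm ℂ)) (fun μ x' => NormedSpace.exp (((((L ^ i.r * L ^ i.kk : ℕ) : ℝ))⁻¹) • A' μ x')) (cvNL' d L i.m i.kk i.r hL a ι - (cvNVq' d L i.m i.kk i.r hL a ι e (fun μ x' => NormedSpace.exp (((((L ^ i.r * L ^ i.kk : ℕ) : ℝ))⁻¹) • A' μ x')))) (fun _ => (cvNVq' d L i.m i.kk i.r hL a ι e (fun μ x' => NormedSpace.exp (((((L ^ i.r * L ^ i.kk : ℕ) : ℝ))⁻¹) • A' μ x')))))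
            (Sum.elim (fun μ => fgrad (((((L ^ i.kk : ℕ) : ℝ))⁻¹))⁻¹ (liftEquiv (bshiftEquiv (cvM d L i.m i.kk hL) (L ^ i.kk) μ) ι)) (fun μ => bgrad (((((L ^ i.kk : ℕ) : ℝ))⁻¹))⁻¹ (liftEquiv (bshiftEquiv (cvM d L i.m i.kk hL) (L ^ i.kk) μ) ι)) j₁ ∘ₗ
              cvGlued d L i.m i.kk hL a ((((L ^ i.kk : ℕ) : ℝ))⁻¹) ι e (fun _ _ => (1 : Matrix mm mm ℂ)) (fun μ x => NormedSpace.exp (((((L ^ i.kk : ℕ) : ℝ))⁻¹) • gavgM (Matrix mm mm ℂ) (Fin (d + 1)) (kingPrV L i.kk i.r (cvM d L i.m i.kk hL)) A' μ x)) (cvNL d L i.m i.kk hL a ι - (cvNVq d L i.m i.kk hL a ι e (fun μ x => NormedSpace.exp (((((L ^ i.kk : ℕ) : ℝ))⁻¹) • gavgM (Matrix mm mm ℂ) (Fin (d + 1)) (kingPrV L i.kk i.r (cvM d L i.m i.kk hL)) A' μ x)))) (fun _ => (cvNVq d L i.m i.kk hL a ι e (fun μ x => NormedSpace.exp (((((L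 ^ i.kk : ℕ) : ℝ))⁻¹) • gavgM (Matrix mm mm ℂ) (Fin (d + 1)) (kingPrV L i.kk i.r (cvM d L i.m i.kk hL)) A' μ x))))))
    (hE2 : ∀ (i : SfIdx d L) (A' : Fin (d + 1) → CvX' d L i.m i.kk i.r hL → Matrix mm mm ℂ), E i 2 A' =
      idef (pull (liftMap (kingPrV L i.kk i.r (cvM d L i.m i.kk hL)) ι)) (pull (liftMap (kingPrV L i.kk i.r (cvM d L i.m i.kk hL)) ι))
            (Sum.elim (fun μ => fgrad (((((L ^ i.r * L ^ i.kk : ℕ) : ℝ))⁻¹))⁻¹ (liftEquiv (bshiftEquiv (cvM d L i.m i.kk hL) (L ^ i.r * L ^ i.kk) μ) ι)) (fun μ => bgrad (((((L ^ i.r * L ^ i.kk : ℕ) : ℝ))⁻¹))⁻¹ (liftEquiv (bshiftEquiv (cvM d L i.m i.kk hL) (L ^ i.r * L ^ i.kk) μ) ι)) j₂ ∘ₗ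
              cvGlued' d L i.m i.kk i.r hL a ((((L ^ i.r * L ^ i.kk : ℕ) : ℝ))⁻¹) ι e (fun _ _ => (1 : Matrix mm mm ℂ)) (fun μ x' => NormedSpace.exp (((((L ^ i.r * L ^ i.kk : ℕ) : ℝ))⁻¹) • A' μ x')) (cvNL' d L i.m i.kk i.r hL a ι - (cvNVq' d L i.m i.kk i.r hL a ι e (fun μ x' => NormedSpace.exp (((((L ^ i.r * L ^ i.kk : ℕ) : ℝ))⁻¹) • A' μ x')))) (fun _ => (cvNVq' d L i.m i.kk i.r hL a ι e (fun μ x' => NormedSpace.exp (((((L ^ i.r * L ^ i.kk : ℕ) : ℝ))⁻¹) • A' μ x')))))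
            (Sum.elim (fun μ => fgrad (((((L ^ i.kk : ℕ) : ℝ))⁻¹))⁻¹ (liftEquiv (bshiftEquiv (cvM d L i.m i.kk hL) (L ^ i.kk) μ) ι)) (fun μ => bgrad (((((L ^ i.kk : ℕ) : ℝ))⁻¹))⁻¹ (liftEquiv (bshiftEquiv (cvM d L i.m i.kk hL) (L ^ i.kk) μ) ι)) j₂ ∘ₗ
              cvGlued d L i.m i.kk hL a ((((L ^ i.kk : ℕ) : ℝ))⁻¹) ι e (fun _ _ => (1 : Matrix mm mm ℂ)) (fun μ x => NormedSpace.exp (((((L ^ i.kk : ℕ) : ℝ))⁻¹) • gavgM (Matrix mm mm ℂ) (Fin (d + 1)) (kingPrV L i.kk i.r (cvM d L i.m i.kk hL)) A' μ x)) (cvNL d L i.m i.kk hL a ι - (cvNVq d L i.m i.kk hL a ι e (fun μ x => NormedSpace.exp (((((L ^ i.kk : ℕ) : ℝ))⁻¹) • gavgM (Matrix mm mm ℂ) (Fin (d + 1)) (kingPrV L i.kk i.r (cvM d L i.m i.kk hL)) A' μ x)))) (fun _ => (cvNVq d L i.m i.kk hL a ι e (fun μ x => NormedSpace.exp (((((L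 ^ i.kk : ℕ) : ℝ))⁻¹) • gavgM (Matrix mm mm ℂ) (Fin (d + 1)) (kingPrV L i.kk i.r (cvM d L i.m i.kk hL)) A' μ x))))))
    (hE3 : ∀ (i : SfIdx d L) (A' : Fin (d + 1) → CvX' d L i.m i.kk i.r hL → Matrix mm mm ℂ), E i 3 A' =
      idef (pull (liftMap (kingPrV L i.kk i.r (cvM d L i.m i.kk hL)) ι)) (pull (liftMap (kingPrV L i.kk i.r (cvM d L i.m i.kk hL)) ι)) ((covLapM (bshiftEquiv (cvM d L i.m i.kk hL) (L ^ i.r * L ^ i.kk)) ((((L ^ i.r * L ^ i.kk : ℕ) : ℝ))⁻¹) (gaugePair (bshiftEquiv (cvM d L i.m i.kk hL) (L ^ i.r * L ^ i.kk)) (fun μ x' => coordMat e (ContinuousLinearMap.mulLeftRight ℝ (Matrix mm mm ℂ) (NormedSpace.exp (((((L ^ i.r * L ^ i.kk : ℕ) : ℝ))⁻¹) • A' μ x')) (NormedSpace.exp (((((L ^ i.r * L ^ i.kk : ℕ) : ℝ))⁻¹) • A' μ x'))ᴴ)))) ∘ₗ (cvGlued' d L i.m i.kk i.r hL a ((((L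 ^ i.r * L ^ i.kk : ℕ) : ℝ))⁻¹) ι e (fun _ _ => (1 : Matrix mm mm ℂ)) (fun μ x' => NormedSpace.exp (((((L ^ i.r * L ^ i.kk : ℕ) : ℝ))⁻¹) • A' μ x')) (cvNL' d L i.m i.kk i.r hL a ι - (cvNVq' d L i.m i.kk i.r hL a ι e (fun μ x' => NormedSpace.exp (((((L ^ i.r * L ^ i.kk : ℕ) : ℝ))⁻¹) • A' μ x')))) (fun _ => (cvNVq' d L i.m i.kk i.r hL a ι e (fun μ x' => NormedSpace.exp (((((L ^ i.r * L ^ i.kk : ℕ) : ℝ))⁻¹) • A' μ x')))))) ((covLapM (bshiftEquiv (cvM d L i.m i.kk hL) (L ^ i.kk)) ((((L ^ i.kk : ℕ) : ℝ))⁻¹) (gaugePair (bshiftEquiv (cvM d L i.m i.kk hL) (L ^ i.kk)) (fun μ x => coordMat e (ContinuousLinearMap.mulLeftRight ℝ (Matrix mm mm ℂ) (NormedSpace.exp (((((L ^ i.kk : ℕ) : ℝ))⁻¹) • gavgM (Matrix mm mm ℂ) (Fin (d + 1)) (kingPrV L i.kk i.r (cvM d L i.m i.kk hL)) A' μ x))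 (NormedSpace.exp (((((L ^ i.kk : ℕ) : ℝ))⁻¹) • gavgM (Matrix mm mm ℂ) (Fin (d + 1)) (kingPrV L i.kk i.r (cvM d L i.m i.kk hL)) A' μ x))ᴴ)))) ∘ₗ (cvGlued d L i.m i.kk hL a ((((L ^ i.kk : ℕ) : ℝ))⁻¹) ι e (fun _ _ => (1 : Matrix mm mm ℂ)) (fun μ x => NormedSpace.exp (((((L ^ i.kk : ℕ) : ℝ))⁻¹) • gavgM (Matrix mm mm ℂ) (Fin (d + 1)) (kingPrV L i.kk i.r (cvM d L i.m i.kk hL)) A' μ x)) (cvNL d L i.m i.kk hL a ι - (cvNVq d L i.m i.kk hL a ι e (fun μ x => NormedSpace.exp (((((L ^ i.kk : ℕ) : ℝ))⁻¹) • gavgM (Matrix mm mm ℂ) (Fin (d + 1)) (kingPrV L i.kk i.r (cvM d L i.m i.kk hL)) A' μ x)))) (fun _ => (cvNVq d L i.m i.kk hL a ι e (fun μ x => NormedSpace.exp (((((L ^ i.kk : ℕ) : ℝ))⁻¹) • gavgM (Matrix mm mm ℂ) (Fin (d + 1)) (kingPrV L i.kk i.r (cvM d L i.m i.kk hL)) A'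 μ x))))))) :
    NE2PlusOperator c35 (sfInstance d mm ι hL) (fun i => sfqFamily d mm ι a e hL i (E i)) := by
  obtain ⟨δ, w₀, R₀, θ₀, R₁, D, hδ, hR₀, hθ₀, hR₁, H⟩ := sfq_idef_jet_cvGlued (d := d) hL hL7 ha ι
  have hLpos : 0 < L := Nat.pos_of_ne_zero (NeZero.ne L)
  have hLr : (0 : ℝ) < (L : ℝ) := Nat.cast_pos.mpr hLpos
  have hL1 : (1 : ℝ) ≤ (L : ℝ) := by exact_mod_cast hLpos
  -- the constants
  have hκ0 : 0 ≤ basisConst e := basisConst_nonneg e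
  have hκF := @basisConst_nonneg ι _ (Matrix mm mm ℂ) Matrix.frobeniusNormedAddCommGroup Matrix.frobeniusNormedSpace e
  let σ : ℝ := 14 * Real.exp 1 * (1 + Fintype.card (Fin (d + 1))) * basisConst e * ((1 + Fintype.card (Fin (d + 1))) * (3 + 2 * ((d : ℝ) + 1)))
  have hσ0 : 0 ≤ σ := by positivity
  let JJ : ℝ := 1 + Fintype.card (Fin (d + 1) ⊕ Fin (d + 1))
  have hJJ0 : 0 ≤ JJ := by positivity
  let W : ℝ := 2 * ((1 + Fintype.card (Fin (d + 1))) * (3 + 2 * ((d : ℝ) + 1)))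
  have hW0 : 0 < W := by positivity
  have hW1 : 1 ≤ W := by
    show (1 : ℝ) ≤ 2 * ((1 + Fintype.card (Fin (d + 1))) * (3 + 2 * ((d : ℝ) + 1)))
    have h1 : (1 : ℝ) ≤ 1 + Fintype.card (Fin (d + 1)) := le_add_of_nonneg_right (Nat.cast_nonneg _)
    have h2 : (1 : ℝ) ≤ 3 + 2 * ((d : ℝ) + 1) := by have := (Nat.cast_nonneg d : (0 : ℝ) ≤ d); linarith
    nlinarith
  let Λ : ℝ := (Fintype.card ι * (@basisConst ι _ (Matrix mm mm ℂ) Matrix.frobeniusNormedAddCommGroup Matrix.frobeniusNormedSpace e * (2 * Real.sqrt (Fintype.card mm)) * Real.sqrt (Fintype.card mm)))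
  have hΛ0 : 0 ≤ Λ := by positivity
  let cΦ : ℝ := (3 ^ (d + 1) * (72 * ((d : ℝ) + 1) ^ 2 + 9 * ((d : ℝ) + 1)) + (2 + 2 * Real.exp 1 + 2 * Real.exp 1 ^ 2 * ((d : ℝ) + 1)))
  have hcΦ0 : 0 ≤ cΦ := by positivity
  let G : ℝ := 8 * ((d : ℝ) + 2) * Λ
  have hG0 : 0 ≤ G := by positivity
  let aW : ℝ := 1 / (W * c35)
  have haW : 0 < aW := by positivity
  let aK : ℝ := 1 / ((4 * ((d : ℝ) + 2) * Λ + 1) * c35)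
  have haK : 0 < aK := by positivity
  let aR : ℝ := R₀ / (σ * c35 * JJ + R₁ * G * c35 + 1)
  have haR : 0 < aR := by positivity
  let aθ : ℝ := θ₀ / (R₁ * G * c35 + 1)
  have haθ : 0 < aθ := by positivity
  let a₀ : ℝ := min aW (min aR (min aθ aK))
  have ha₀ : 0 < a₀ := lt_min haW (lt_min haR (lt_min haθ haK))
  have ha₀W : a₀ ≤ aW := min_le_left _ _
  have ha₀R : a₀ ≤ aR := (min_le_right _ _).trans (min_le_left _ _)
  have ha₀θ : a₀ ≤ aθ := (min_le_right _ _).trans ((min_le_right _ _).trans (min_le_left _ _))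
  have ha₀K : a₀ ≤ aK := (min_le_right _ _).trans ((min_le_right _ _).trans (min_le_right _ _))
  let M₅ : ℝ := max w₀ 1
  have hM₅ : 0 < M₅ := lt_of_lt_of_le one_pos (le_max_right _ _)
  let C₁ : ℝ := σ * (c35 * a₀) * JJ + 2 * (R₁ * (20 + 4 * (Λ * cΦ * (c35 * a₀))))
  have hC₁0 : 0 ≤ C₁ := by positivity
  let B₀ : ℝ := max D 0 * (1 + C₁) + 1
  have hB₀ : 0 < B₀ := add_pos_of_nonneg_of_pos (by positivity) one_pos
  refine ne2PlusOperator_sfq₃ d mm ι e hL hL7 ha hc35 he E hE3 ⟨M₅, δ / 16, a₀, B₀, 1 / 16, hM₅, by positivity, ha₀, hB₀, by norm_num, fun i hM α₀ hα₀ hMa A' hA' n hn0 hn3 => ?_⟩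
  -- the guard `M₅ ≤ gf.M = L^m`
  have hM' : M₅ ≤ (L : ℝ) ^ i.m := hM
  have hw₀ : w₀ ≤ ((L ^ i.m : ℕ) : ℝ) := by push_cast; exact (le_max_left _ _).trans hM'
  have hη0 : (0 : ℝ) ≤ (sfGeo d hL i).eta := by
    show (0 : ℝ) ≤ ((L : ℝ) ^ i.kk)⁻¹
    positivity
  -- the scalar facts at the index
  have hx1 : (1 : ℝ) ≤ (L : ℝ) ^ i.kk := one_le_pow₀ hL1
  have hxpos : (0 : ℝ) < (L : ℝ) ^ i.kk := pow_pos hLr _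
  have hcast : (((L ^ i.kk : ℕ) : ℝ)) = (L : ℝ) ^ i.kk := by push_cast; rfl
  have hrf : ∀ y : (sfGeo d hL i).Site, ∀ γ' : ℝ, rateFactor (opGeo (sfGeo d hL i) (CvX d L i.m i.kk hL × ι) (liftBlk (cvBlk d L i.m i.kk hL) ι)) γ' y = ((L : ℝ) ^ i.kk) ^ (-γ') :=
    fun y γ' => sfGeo_rateFactor d hL i _ γ' y
  have hrfγ : ((L : ℝ) ^ i.kk) ^ (-(1 / 16 : ℝ)) ≤ ((L : ℝ) ^ i.kk) ^ (-(1 / 16 : ℝ)) := le_rfl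
  have hinv : ((L : ℝ) ^ i.kk)⁻¹ ≤ ((L : ℝ) ^ i.kk) ^ (-(1 / 16 : ℝ)) := by
    rw [← Real.rpow_neg_one]
    exact Real.rpow_le_rpow_of_exponent_le hx1 (by norm_num)
  have hδ₀le : δ / 16 ≤ δ / 16 := le_rfl
  -- ENTRIES 1–2: n15-c∕190 at the pinned jet index
  obtain ⟨hskew, h1F, h2F, h3F⟩ := (sfInstance_reg335_iff d mm ι hL i c35 α₀ A').1 hA'
  have hconv : ((L : ℝ) ^ i.kk)⁻¹ * ((L : ℝ) ^ i.r)⁻¹ = ((((L ^ i.r * L ^ i.kk : ℕ) : ℝ))⁻¹) := by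
    push_cast
    rw [mul_inv, mul_comm]
  have hrA0 : 0 ≤ (c35 * (L : ℝ) ^ i.m * α₀) := by positivity
  have hrAa : (c35 * (L : ℝ) ^ i.m * α₀) ≤ c35 * a₀ := by
    rw [mul_assoc]; exact mul_le_mul_of_nonneg_left hMa hc35.le
  -- Frobenius letters of the class ⟹ operator-norm letters
  have h1 : ∀ μ x', ‖A' μ x'‖ ≤ (c35 * (L : ℝ) ^ i.m * α₀) := fun μ x' => (l2_opNorm_le_frobenius_norm _).trans (h1F μ x')
  have h2' : ∀ μ κ x', ‖A' μ (bshiftEquiv (cvM d L i.m i.kk hL) (L ^ i.r * L ^ i.kk) κ x') - A' μ x'‖ ≤ (c35 * (L : ℝ) ^ i.m * α₀) * ((((L ^ i.r * L ^ i.kk : ℕ) : ℝ))⁻¹) :=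
    fun μ κ x' => ((l2_opNorm_le_frobenius_norm _).trans (h2F μ κ x')).trans_eq (by rw [hconv])
  have h3' : ∀ μ κ x', ‖(A' μ (bshiftEquiv (cvM d L i.m i.kk hL) (L ^ i.r * L ^ i.kk) κ x') - A' μ x') -
      (A' μ (bshiftEquiv (cvM d L i.m i.kk hL) (L ^ i.r * L ^ i.kk) κ ((bshiftEquiv (cvM d L i.m i.kk hL) (L ^ i.r * L ^ i.kk) μ).symm x')) -
        A' μ ((bshiftEquiv (cvM d L i.m i.kk hL) (L ^ i.r * L ^ i.kk) μ).symm x'))‖ ≤ (c35 * (L : ℝ) ^ i.m * α₀) * ((((L ^ i.r * L ^ i.kk : ℕ) : ℝ))⁻¹) * ((((L ^ i.r * L ^ i.kk : ℕ) : ℝ))⁻¹) :=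
    fun μ κ x' => ((l2_opNorm_le_frobenius_norm _).trans (h3F μ κ x')).trans_eq (by rw [hconv])
  -- the window `W·r_A ≤ 1`, hence `r_A ≤ 1`
  have hWa : W * (c35 * a₀) ≤ 1 := by
    calc W * (c35 * a₀) ≤ W * (c35 * aW) := mul_le_mul_of_nonneg_left (mul_le_mul_of_nonneg_left ha₀W hc35.le) hW0.le
      _ = 1 := by
        show W * (c35 * (1 / (W * c35))) = 1
        field_simp
  have hr2 : 2 * ((1 + Fintype.card (Fin (d + 1))) * ((3 + 2 * ((d : ℝ) + 1)) * (c35 * (L : ℝ) ^ i.m * α₀))) ≤ 1 := by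
    calc 2 * ((1 + Fintype.card (Fin (d + 1))) * ((3 + 2 * ((d : ℝ) + 1)) * (c35 * (L : ℝ) ^ i.m * α₀))) = W * (c35 * (L : ℝ) ^ i.m * α₀) := by ring
      _ ≤ W * (c35 * a₀) := mul_le_mul_of_nonneg_left hrAa hW0.le
      _ ≤ 1 := hWa
  have hca0 : 0 ≤ c35 * a₀ := by positivity
  have hrA1 : (c35 * (L : ℝ) ^ i.m * α₀) ≤ 1 := by
    calc (c35 * (L : ℝ) ^ i.m * α₀) ≤ c35 * a₀ := hrAa
      _ ≤ W * (c35 * a₀) := le_mul_of_one_le_left hca0 hW1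
      _ ≤ 1 := hWa
  -- the transporter sizes `K, K₁ ≤ 4(d+2)Λ·r_A ≤ 1`
  have hKa : 4 * ((d : ℝ) + 2) * Λ * (c35 * a₀) ≤ 1 := by
    calc 4 * ((d : ℝ) + 2) * Λ * (c35 * a₀) ≤ 4 * ((d : ℝ) + 2) * Λ * (c35 * aK) := mul_le_mul_of_nonneg_left (mul_le_mul_of_nonneg_left ha₀K hc35.le) (by positivity)
      _ ≤ (4 * ((d : ℝ) + 2) * Λ + 1) * (c35 * aK) := mul_le_mul_of_nonneg_right (by linarith) (by positivity)
      _ = 1 := by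
        show (4 * ((d : ℝ) + 2) * Λ + 1) * (c35 * (1 / ((4 * ((d : ℝ) + 2) * Λ + 1) * c35))) = 1
        field_simp
  have hKr : 4 * ((d : ℝ) + 2) * Λ * (c35 * (L : ℝ) ^ i.m * α₀) ≤ 1 := (mul_le_mul_of_nonneg_left hrAa (by positivity)).trans hKa
  have hx2 : 0 ≤ 2 * ((d : ℝ) + 2) * Λ * (c35 * (L : ℝ) ^ i.m * α₀) := by positivity
  have hx2' : 2 * ((d : ℝ) + 2) * Λ * (c35 * (L : ℝ) ^ i.m * α₀) ≤ 1 := by linarith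
  have hKc : ((1 + Fintype.card ι * (@basisConst ι _ (Matrix mm mm ℂ) Matrix.frobeniusNormedAddCommGroup Matrix.frobeniusNormedSpace e * (2 * Real.sqrt (Fintype.card mm)) * (Real.sqrt (Fintype.card mm) * (2 * ((c35 * (L : ℝ) ^ i.m * α₀) * ((((L ^ i.kk : ℕ) : ℝ))⁻¹)))))) ^ ((d + 2) * L ^ i.kk) - 1) ≤ 4 * ((d : ℝ) + 2) * Λ * (c35 * (L : ℝ) ^ i.m * α₀) := by
    have hy0 : 0 ≤ Fintype.card ι * (@basisConst ι _ (Matrix mm mm ℂ) Matrix.frobeniusNormedAddCommGroup Matrix.frobeniusNormedSpace e * (2 * Real.sqrt (Fintype.card mm)) * (Real.sqrt (Fintype.card mm) * (2 * ((c35 * (L : ℝ) ^ i.m * α₀) * ((((L ^ i.kk : ℕ) : ℝ))⁻¹))))) := by positivity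
    refine (pow_sub_one_le_exp_sub_one hy0 _).trans ?_
    have hexp : Fintype.card ι * (@basisConst ι _ (Matrix mm mm ℂ) Matrix.frobeniusNormedAddCommGroup Matrix.frobeniusNormedSpace e * (2 * Real.sqrt (Fintype.card mm)) * (Real.sqrt (Fintype.card mm) * (2 * ((c35 * (L : ℝ) ^ i.m * α₀) * ((((L ^ i.kk : ℕ) : ℝ))⁻¹))))) * (((d + 2) * L ^ i.kk : ℕ) : ℝ) = 2 * ((d : ℝ) + 2) * Λ * (c35 * (L : ℝ) ^ i.m * α₀) := by
      have hk0 : (((L ^ i.kk : ℕ) : ℝ)) ≠ 0 := by rw [hcast]; exact hxpos.ne'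
      push_cast
      field_simp
      ring
    rw [hexp]
    have h := exp_sub_one_le_two_mul hx2 hx2'
    linarith
  have hKf : ((1 + Fintype.card ι * (@basisConst ι _ (Matrix mm mm ℂ) Matrix.frobeniusNormedAddCommGroup Matrix.frobeniusNormedSpace e * (2 * Real.sqrt (Fintype.card mm)) * (Real.sqrt (Fintype.card mm) * (2 * ((c35 * (L : ℝ) ^ i.m * α₀) * ((((L ^ i.r * L ^ i.kk : ℕ) : ℝ))⁻¹)))))) ^ ((d + 2) * (L ^ i.r * L ^ i.kk)) - 1) ≤ 4 * ((d : ℝ) + 2) * Λ * (c35 * (L : ℝ) ^ i.m * α₀) := by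
    have hy0 : 0 ≤ Fintype.card ι * (@basisConst ι _ (Matrix mm mm ℂ) Matrix.frobeniusNormedAddCommGroup Matrix.frobeniusNormedSpace e * (2 * Real.sqrt (Fintype.card mm)) * (Real.sqrt (Fintype.card mm) * (2 * ((c35 * (L : ℝ) ^ i.m * α₀) * ((((L ^ i.r * L ^ i.kk : ℕ) : ℝ))⁻¹))))) := by positivity
    refine (pow_sub_one_le_exp_sub_one hy0 _).trans ?_
    have hexp : Fintype.card ι * (@basisConst ι _ (Matrix mm mm ℂ) Matrix.frobeniusNormedAddCommGroup Matrix.frobeniusNormedSpace e * (2 * Real.sqrt (Fintype.card mm)) * (Real.sqrt (Fintype.card mm) * (2 * ((c35 * (L : ℝ) ^ i.m * α₀) * ((((L ^ i.r * L ^ i.kk : ℕ) : ℝ))⁻¹))))) * (((d + 2) * (L ^ i.r * L ^ i.kk) : ℕ) : ℝ) = 2 * ((d : ℝ) + 2) * Λ * (c35 * (L : ℝ) ^ i.m * α₀) := by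
      have hk0 : (((L ^ i.r * L ^ i.kk : ℕ) : ℝ)) ≠ 0 := Nat.cast_ne_zero.mpr (Nat.pos_iff_ne_zero.mp (Nat.mul_pos (pow_pos hLpos _) (pow_pos hLpos _)))
      field_simp
      push_cast
      ring
    rw [hexp]
    have h := exp_sub_one_le_two_mul hx2 hx2'
    linarith
  have hKc1 : ((1 + Fintype.card ι * (@basisConst ι _ (Matrix mm mm ℂ) Matrix.frobeniusNormedAddCommGroup Matrix.frobeniusNormedSpace e * (2 * Real.sqrt (Fintype.card mm)) * (Real.sqrt (Fintype.card mm) * (2 * ((c35 * (L : ℝ) ^ i.m * α₀) * ((((L ^ i.kk : ℕ) : ℝ))⁻¹)))))) ^ ((d + 2) * L ^ i.kk) - 1) ≤ 1 := hKc.trans hKr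
  have hKf1 : ((1 + Fintype.card ι * (@basisConst ι _ (Matrix mm mm ℂ) Matrix.frobeniusNormedAddCommGroup Matrix.frobeniusNormedSpace e * (2 * Real.sqrt (Fintype.card mm)) * (Real.sqrt (Fintype.card mm) * (2 * ((c35 * (L : ℝ) ^ i.m * α₀) * ((((L ^ i.r * L ^ i.kk : ℕ) : ℝ))⁻¹)))))) ^ ((d + 2) * (L ^ i.r * L ^ i.kk)) - 1) ≤ 1 := hKf.trans hKr
  have hKC0 : 0 ≤ ((1 + Fintype.card ι * (@basisConst ι _ (Matrix mm mm ℂ) Matrix.frobeniusNormedAddCommGroup Matrix.frobeniusNormedSpace e * (2 * Real.sqrt (Fintype.card mm)) * (Real.sqrt (Fintype.card mm) * (2 * ((c35 * (L : ℝ) ^ i.m * α₀) * ((((L ^ i.kk : ℕ) : ℝ))⁻¹)))))) ^ ((d + 2) * L ^ i.kk) - 1) := by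
    have := one_le_pow₀ (M₀ := ℝ) (a := 1 + Fintype.card ι * (@basisConst ι _ (Matrix mm mm ℂ) Matrix.frobeniusNormedAddCommGroup Matrix.frobeniusNormedSpace e * (2 * Real.sqrt (Fintype.card mm)) * (Real.sqrt (Fintype.card mm) * (2 * ((c35 * (L : ℝ) ^ i.m * α₀) * ((((L ^ i.kk : ℕ) : ℝ))⁻¹)))))) (by linarith [show (0:ℝ) ≤ Fintype.card ι * (@basisConst ι _ (Matrix mm mm ℂ) Matrix.frobeniusNormedAddCommGroup Matrix.frobeniusNormedSpace e * (2 * Real.sqrt (Fintype.card mm)) * (Real.sqrt (Fintype.card mm) * (2 * ((c35 * (L : ℝ) ^ i.m * α₀) * ((((L ^ i.kk : ℕ) : ℝ))⁻¹))))) by positivity]) (n := (d + 2) * L ^ i.kk); linarith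
  have hKF0 : 0 ≤ ((1 + Fintype.card ι * (@basisConst ι _ (Matrix mm mm ℂ) Matrix.frobeniusNormedAddCommGroup Matrix.frobeniusNormedSpace e * (2 * Real.sqrt (Fintype.card mm)) * (Real.sqrt (Fintype.card mm) * (2 * ((c35 * (L : ℝ) ^ i.m * α₀) * ((((L ^ i.r * L ^ i.kk : ℕ) : ℝ))⁻¹)))))) ^ ((d + 2) * (L ^ i.r * L ^ i.kk)) - 1) := by
    have := one_le_pow₀ (M₀ := ℝ) (a := 1 + Fintype.card ι * (@basisConst ι _ (Matrix mm mm ℂ) Matrix.frobeniusNormedAddCommGroup Matrix.frobeniusNormedSpace e * (2 * Real.sqrt (Fintype.card mm)) * (Real.sqrt (Fintype.card mm) * (2 * ((c35 * (L : ℝ) ^ i.m * α₀) * ((((L ^ i.r * L ^ i.kk : ℕ) : ℝ))⁻¹)))))) (by linarith [show (0:ℝ) ≤ Fintype.card ι * (@basisConst ι _ (Matrix mm mm ℂ) Matrix.frobeniusNormedAddCommGroup Matrix.frobeniusNormedSpace e * (2 * Real.sqrt (Fintype.card mm)) * (Real.sqrt (Fintype.card mm) * (2 * ((c35 * (L : ℝ)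 ^ i.m * α₀) * ((((L ^ i.r * L ^ i.kk : ℕ) : ℝ))⁻¹))))) by positivity]) (n := (d + 2) * (L ^ i.r * L ^ i.kk)); linarith
  have hKsum : R₁ * (((1 + Fintype.card ι * (@basisConst ι _ (Matrix mm mm ℂ) Matrix.frobeniusNormedAddCommGroup Matrix.frobeniusNormedSpace e * (2 * Real.sqrt (Fintype.card mm)) * (Real.sqrt (Fintype.card mm) * (2 * ((c35 * (L : ℝ) ^ i.m * α₀) * ((((L ^ i.kk : ℕ) : ℝ))⁻¹)))))) ^ ((d + 2) * L ^ i.kk) - 1) + ((1 + Fintype.card ι * (@basisConst ι _ (Matrix mm mm ℂ) Matrix.frobeniusNormedAddCommGroup Matrix.frobeniusNormedSpace e * (2 * Real.sqrt (Fintype.card mm)) * (Real.sqrt (Fintype.card mm) * (2 * ((c35 * (L : ℝ) ^ i.m * α₀) * ((((L ^ i.r * L ^ i.kk : ℕ) : ℝ))⁻¹)))))) ^ ((d + 2) * (L ^ i.r * L ^ i.kk)) - 1)) ≤ R₁ * G * (c35 * a₀) := by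
    have h8 : ((1 + Fintype.card ι * (@basisConst ι _ (Matrix mm mm ℂ) Matrix.frobeniusNormedAddCommGroup Matrix.frobeniusNormedSpace e * (2 * Real.sqrt (Fintype.card mm)) * (Real.sqrt (Fintype.card mm) * (2 * ((c35 * (L : ℝ) ^ i.m * α₀) * ((((L ^ i.kk : ℕ) : ℝ))⁻¹)))))) ^ ((d + 2) * L ^ i.kk) - 1) + ((1 + Fintype.card ι * (@basisConst ι _ (Matrix mm mm ℂ) Matrix.frobeniusNormedAddCommGroup Matrix.frobeniusNormedSpace e * (2 * Real.sqrt (Fintype.card mm)) * (Real.sqrt (Fintype.card mm) * (2 * ((c35 * (L : ℝ) ^ i.m * α₀) * ((((L ^ i.r * L ^ i.kk : ℕ) : ℝ))⁻¹)))))) ^ ((d + 2) * (L ^ i.r * L ^ i.kk)) - 1) ≤ G * (c35 * (L : ℝ) ^ i.m * α₀) := by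
      show ((1 + Fintype.card ι * (@basisConst ι _ (Matrix mm mm ℂ) Matrix.frobeniusNormedAddCommGroup Matrix.frobeniusNormedSpace e * (2 * Real.sqrt (Fintype.card mm)) * (Real.sqrt (Fintype.card mm) * (2 * ((c35 * (L : ℝ) ^ i.m * α₀) * ((((L ^ i.kk : ℕ) : ℝ))⁻¹)))))) ^ ((d + 2) * L ^ i.kk) - 1) + ((1 + Fintype.card ι * (@basisConst ι _ (Matrix mm mm ℂ) Matrix.frobeniusNormedAddCommGroup Matrix.frobeniusNormedSpace e * (2 * Real.sqrt (Fintype.card mm)) * (Real.sqrt (Fintype.card mm) * (2 * ((c35 * (L : ℝ) ^ i.m * α₀) * ((((L ^ i.r * L ^ i.kk : ℕ) : ℝ))⁻¹)))))) ^ ((d + 2) * (L ^ i.r * L ^ i.kk)) - 1) ≤ 8 * ((d : ℝ) + 2) * Λ * (c35 * (L : ℝ) ^ i.m * α₀)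
      linarith
    calc R₁ * (((1 + Fintype.card ι * (@basisConst ι _ (Matrix mm mm ℂ) Matrix.frobeniusNormedAddCommGroup Matrix.frobeniusNormedSpace e * (2 * Real.sqrt (Fintype.card mm)) * (Real.sqrt (Fintype.card mm) * (2 * ((c35 * (L : ℝ) ^ i.m * α₀) * ((((L ^ i.kk : ℕ) : ℝ))⁻¹)))))) ^ ((d + 2) * L ^ i.kk) - 1) + ((1 + Fintype.card ι * (@basisConst ι _ (Matrix mm mm ℂ) Matrix.frobeniusNormedAddCommGroup Matrix.frobeniusNormedSpace e * (2 * Real.sqrt (Fintype.card mm)) * (Real.sqrt (Fintype.card mm) * (2 * ((c35 * (L : ℝ) ^ i.m * α₀) * ((((L ^ i.r * L ^ i.kk : ℕ) : ℝ))⁻¹)))))) ^ ((d + 2) * (L ^ i.r * L ^ i.kk)) - 1)) ≤ R₁ * (G * (c35 * (L : ℝ) ^ i.m * α₀)) := mul_le_mul_of_nonneg_left h8 hR₁.le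
      _ ≤ R₁ * (G * (c35 * a₀)) := mul_le_mul_of_nonneg_left (mul_le_mul_of_nonneg_left hrAa hG0) hR₁.le
      _ = R₁ * G * (c35 * a₀) := by ring
  -- the scale conditions of n15-c∕188
  have hscale : (14 * Real.exp 1 * (1 + Fintype.card (Fin (d + 1))) * basisConst e * ((1 + Fintype.card (Fin (d + 1))) * ((3 + 2 * ((d : ℝ) + 1)) * (c35 * (L : ℝ) ^ i.m * α₀)))) = σ * (c35 * (L : ℝ) ^ i.m * α₀) := by ring
  have hSle : σ * (c35 * (L : ℝ) ^ i.m * α₀) ≤ σ * (c35 * a₀) := mul_le_mul_of_nonneg_left hrAa hσ0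
  have hRle : (14 * Real.exp 1 * (1 + Fintype.card (Fin (d + 1))) * basisConst e * ((1 + Fintype.card (Fin (d + 1))) * ((3 + 2 * ((d : ℝ) + 1)) * (c35 * (L : ℝ) ^ i.m * α₀)))) * (1 + Fintype.card (Fin (d + 1) ⊕ Fin (d + 1))) + R₁ * (((1 + Fintype.card ι * (@basisConst ι _ (Matrix mm mm ℂ) Matrix.frobeniusNormedAddCommGroup Matrix.frobeniusNormedSpace e * (2 * Real.sqrt (Fintype.card mm)) * (Real.sqrt (Fintype.card mm) * (2 * ((c35 * (L : ℝ) ^ i.m * α₀) * ((((L ^ i.kk : ℕ) : ℝ))⁻¹)))))) ^ ((d + 2) * L ^ i.kk) - 1) + ((1 + Fintype.card ι * (@basisConst ι _ (Matrix mm mm ℂ) Matrix.frobeniusNormedAddCommGroup Matrix.frobeniusNormedSpace e * (2 * Real.sqrt (Fintype.card mm)) * (Real.sqrt (Fintype.card mm) * (2 * ((c35 * (L : ℝ) ^ i.m * α₀) * ((((L ^ i.r * L ^ i.kk : ℕ) : ℝ))⁻¹)))))) ^ ((d + 2) * (L ^ i.r * L ^ i.kk)) - 1)) ≤ R₀ :=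 by
    rw [hscale]
    have hRa : (σ * c35 * JJ + R₁ * G * c35) * aR ≤ R₀ := by
      have hden : 0 < σ * c35 * JJ + R₁ * G * c35 + 1 := by positivity
      calc (σ * c35 * JJ + R₁ * G * c35) * aR = R₀ * (σ * c35 * JJ + R₁ * G * c35) / (σ * c35 * JJ + R₁ * G * c35 + 1) := by
            show (σ * c35 * JJ + R₁ * G * c35) * (R₀ / (σ * c35 * JJ + R₁ * G * c35 + 1)) = R₀ * (σ * c35 * JJ + R₁ * G * c35) / (σ * c35 * JJ + R₁ * G * c35 + 1)
            field_simp
        _ ≤ R₀ * (σ * c35 * JJ + R₁ * G * c35 + 1) / (σ * c35 * JJ + R₁ * G * c35 + 1) :=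
            div_le_div_of_nonneg_right (mul_le_mul_of_nonneg_left (by linarith) hR₀.le) hden.le
        _ = R₀ := by field_simp
    have hco0 : 0 ≤ σ * c35 * JJ + R₁ * G * c35 := by positivity
    calc σ * (c35 * (L : ℝ) ^ i.m * α₀) * JJ + R₁ * (((1 + Fintype.card ι * (@basisConst ι _ (Matrix mm mm ℂ) Matrix.frobeniusNormedAddCommGroup Matrix.frobeniusNormedSpace e * (2 * Real.sqrt (Fintype.card mm)) * (Real.sqrt (Fintype.card mm) * (2 * ((c35 * (L : ℝ) ^ i.m * α₀) * ((((L ^ i.kk : ℕ) : ℝ))⁻¹)))))) ^ ((d + 2) * L ^ i.kk) - 1) + ((1 + Fintype.card ι * (@basisConst ι _ (Matrix mm mm ℂ) Matrix.frobeniusNormedAddCommGroup Matrix.frobeniusNormedSpace e * (2 * Real.sqrt (Fintype.card mm)) * (Real.sqrt (Fintype.card mm) * (2 * ((c35 * (L : ℝ) ^ i.m * α₀) * ((((L ^ i.r * L ^ i.kk : ℕ) : ℝ))⁻¹)))))) ^ ((d + 2) * (L ^ i.r * L ^ i.kk)) - 1)) ≤ σ * (c35 * a₀) * JJ + R₁ *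 G * (c35 * a₀) := add_le_add (mul_le_mul_of_nonneg_right hSle hJJ0) hKsum
      _ = (σ * c35 * JJ + R₁ * G * c35) * a₀ := by ring
      _ ≤ (σ * c35 * JJ + R₁ * G * c35) * aR := mul_le_mul_of_nonneg_left ha₀R hco0
      _ ≤ R₀ := hRa
  have hθle : R₁ * (((1 + Fintype.card ι * (@basisConst ι _ (Matrix mm mm ℂ) Matrix.frobeniusNormedAddCommGroup Matrix.frobeniusNormedSpace e * (2 * Real.sqrt (Fintype.card mm)) * (Real.sqrt (Fintype.card mm) * (2 * ((c35 * (L : ℝ) ^ i.m * α₀) * ((((L ^ i.kk : ℕ) : ℝ))⁻¹)))))) ^ ((d + 2) * L ^ i.kk) - 1) + ((1 + Fintype.card ι * (@basisConst ι _ (Matrix mm mm ℂ) Matrix.frobeniusNormedAddCommGroup Matrix.frobeniusNormedSpace e * (2 * Real.sqrt (Fintype.card mm)) * (Real.sqrt (Fintype.card mm) * (2 * ((c35 * (L : ℝ) ^ i.m * α₀) * ((((L ^ i.r * L ^ i.kk : ℕ) : ℝ))⁻¹)))))) ^ ((d + 2) * (L ^ i.r * L ^ i.kk)) - 1)) ≤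 θ₀ := by
    have hθa : (R₁ * G * c35) * aθ ≤ θ₀ := by
      have hden : 0 < R₁ * G * c35 + 1 := by positivity
      calc (R₁ * G * c35) * aθ = θ₀ * (R₁ * G * c35) / (R₁ * G * c35 + 1) := by
            show (R₁ * G * c35) * (θ₀ / (R₁ * G * c35 + 1)) = θ₀ * (R₁ * G * c35) / (R₁ * G * c35 + 1)
            field_simp
        _ ≤ θ₀ * (R₁ * G * c35 + 1) / (R₁ * G * c35 + 1) := div_le_div_of_nonneg_right (mul_le_mul_of_nonneg_left (by linarith) hθ₀.le) hden.le
        _ = θ₀ := by field_simp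
    have hco0 : 0 ≤ R₁ * G * c35 := by positivity
    calc R₁ * (((1 + Fintype.card ι * (@basisConst ι _ (Matrix mm mm ℂ) Matrix.frobeniusNormedAddCommGroup Matrix.frobeniusNormedSpace e * (2 * Real.sqrt (Fintype.card mm)) * (Real.sqrt (Fintype.card mm) * (2 * ((c35 * (L : ℝ) ^ i.m * α₀) * ((((L ^ i.kk : ℕ) : ℝ))⁻¹)))))) ^ ((d + 2) * L ^ i.kk) - 1) + ((1 + Fintype.card ι * (@basisConst ι _ (Matrix mm mm ℂ) Matrix.frobeniusNormedAddCommGroup Matrix.frobeniusNormedSpace e * (2 * Real.sqrt (Fintype.card mm)) * (Real.sqrt (Fintype.card mm) * (2 * ((c35 * (L : ℝ) ^ i.m * α₀) * ((((L ^ i.r * L ^ i.kk : ℕ) : ℝ))⁻¹)))))) ^ ((d + 2) * (L ^ i.r * L ^ i.kk)) - 1)) ≤ R₁ * G * (c35 * a₀) := hKsum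
      _ = (R₁ * G * c35) * a₀ := by ring
      _ ≤ (R₁ * G * c35) * aθ := mul_le_mul_of_nonneg_left ha₀θ hco0
      _ ≤ θ₀ := hθa
  have key := fun j : Fin (d + 1) ⊕ Fin (d + 1) => hasMaj_unitTorusGeoS (d := d) (L := L) ((L : ℝ) ^ i.m)
    (H i.m i.kk i.r j i.one_le hw₀ e he A' hskew (c35 * (L : ℝ) ^ i.m * α₀) hrA0 hrA1 h1 h2' h3' hr2 hRle hθle hKc1 hKf1)
  have hEn : ∃ j : Fin (d + 1) ⊕ Fin (d + 1), E i n A' =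
    idef (pull (liftMap (kingPrV L i.kk i.r (cvM d L i.m i.kk hL)) ι)) (pull (liftMap (kingPrV L i.kk i.r (cvM d L i.m i.kk hL)) ι))
          (Sum.elim (fun μ => fgrad (((((L ^ i.r * L ^ i.kk : ℕ) : ℝ))⁻¹))⁻¹ (liftEquiv (bshiftEquiv (cvM d L i.m i.kk hL) (L ^ i.r * L ^ i.kk) μ) ι)) (fun μ => bgrad (((((L ^ i.r * L ^ i.kk : ℕ) : ℝ))⁻¹))⁻¹ (liftEquiv (bshiftEquiv (cvM d L i.m i.kk hL) (L ^ i.r * L ^ i.kk) μ) ι)) j ∘ₗ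
            cvGlued' d L i.m i.kk i.r hL a ((((L ^ i.r * L ^ i.kk : ℕ) : ℝ))⁻¹) ι e (fun _ _ => (1 : Matrix mm mm ℂ)) (fun μ x' => NormedSpace.exp (((((L ^ i.r * L ^ i.kk : ℕ) : ℝ))⁻¹) • A' μ x')) (cvNL' d L i.m i.kk i.r hL a ι - (cvNVq' d L i.m i.kk i.r hL a ι e (fun μ x' => NormedSpace.exp (((((L ^ i.r * L ^ i.kk : ℕ) : ℝ))⁻¹) • A' μ x')))) (fun _ => (cvNVq' d L i.m i.kk i.r hL a ι e (fun μ x' => NormedSpace.exp (((((L ^ i.r * L ^ i.kk : ℕ) : ℝ))⁻¹) • A' μ x')))))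
          (Sum.elim (fun μ => fgrad (((((L ^ i.kk : ℕ) : ℝ))⁻¹))⁻¹ (liftEquiv (bshiftEquiv (cvM d L i.m i.kk hL) (L ^ i.kk) μ) ι)) (fun μ => bgrad (((((L ^ i.kk : ℕ) : ℝ))⁻¹))⁻¹ (liftEquiv (bshiftEquiv (cvM d L i.m i.kk hL) (L ^ i.kk) μ) ι)) j ∘ₗ
            cvGlued d L i.m i.kk hL a ((((L ^ i.kk : ℕ) : ℝ))⁻¹) ι e (fun _ _ => (1 : Matrix mm mm ℂ)) (fun μ x => NormedSpace.exp (((((L ^ i.kk : ℕ) : ℝ))⁻¹) • gavgM (Matrix mm mm ℂ) (Fin (d + 1)) (kingPrV L i.kk i.r (cvM d L i.m i.kk hL)) A' μ x)) (cvNL d L i.m i.kk hL a ι - (cvNVq d L i.m i.kk hL a ι e (fun μ x => NormedSpace.exp (((((L ^ i.kk : ℕ) : ℝ))⁻¹) • gavgM (Matrix mm mm ℂ) (Fin (d + 1)) (kingPrV L i.kk i.r (cvM d L i.m i.kk hL)) A' μ x)))) (fun _ => (cvNVq d L i.m i.kk hL a ι e (fun μ x => NormedSpace.exp (((((L ^ i.kk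 : ℕ) : ℝ))⁻¹) • gavgM (Matrix mm mm ℂ) (Fin (d + 1)) (kingPrV L i.kk i.r (cvM d L i.m i.kk hL)) A' μ x))))) := by
    have hn : n = 1 ∨ n = 2 := by
      rcases n with ⟨n, hn⟩
      simp only [ne_eq, Fin.ext_iff, Fin.val_zero] at hn0 hn3 ⊢
      simp only [show ((3 : Fin 4) : ℕ) = 3 from rfl] at hn3
      simp only [show ((1 : Fin 4) : ℕ) = 1 from rfl, show ((2 : Fin 4) : ℕ) = 2 from rfl]
      omega
    rcases hn with rfl | rfl
    · exact ⟨j₁, hE1 i A'⟩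
    · exact ⟨j₂, hE2 i A'⟩
  obtain ⟨j, hEj⟩ := hEn
  rw [hEj]
  refine (key j).mono fun y y' => ?_
  -- the scalar comparison of the two kernels
  rw [opGeo_len, sfGeo_len d hL i y, hrf y (1 / 16), hrf y' (1 / 16), max_self, hcast]
  have hpref : B9.pref4 (1 : ℝ) n = 1 := by fin_cases n <;> simp [B9.pref4]
  rw [hpref, mul_one]
  have hd0 : 0 ≤ (sfGeo d hL i).dist y y' := sfGeo_dist_nonneg d hL i y y'
  have hexp : Real.exp (-(δ / 16 * (Literature.MathematicalPhysics.QuantumFieldTheory.Balaban1983to89.B6UnitTorusCarrier.unitTorusGeo L i.kk (cvM d L i.m i.kk hL)).dist y y')) ≤ Real.exp (-(δ / 16 * (sfGeo d hL i).dist y y')) := by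
    refine Real.exp_le_exp.mpr (neg_le_neg ?_)
    exact mul_le_mul_of_nonneg_right hδ₀le hd0
  have hE0 : 0 ≤ Real.exp (-(δ / 16 * (Literature.MathematicalPhysics.QuantumFieldTheory.Balaban1983to89.B6UnitTorusCarrier.unitTorusGeo L i.kk (cvM d L i.m i.kk hL)).dist y y')) := Real.exp_nonneg _
  have hre : σ * (c35 * (L : ℝ) ^ i.m * α₀) * (1 + Fintype.card (Fin (d + 1) ⊕ Fin (d + 1))) * ((L : ℝ) ^ i.kk)⁻¹ + 2 * (R₁ * (20 * ((L : ℝ) ^ i.kk)⁻¹ + 4 * Fintype.card ι * (@basisConst ι _ (Matrix mm mm ℂ) Matrix.frobeniusNormedAddCommGroup Matrix.frobeniusNormedSpace e * (2 * Real.sqrt (Fintype.card mm)) * (Real.sqrt (Fintype.card mm) * ((3 ^ (d + 1) * (72 * ((d : ℝ) + 1) ^ 2 + 9 * ((d : ℝ) + 1)) + (2 + 2 * Real.exp 1 + 2 * Real.exp 1 ^ 2 * ((d : ℝ) + 1))) * ((c35 * (L : ℝ) ^ i.m * α₀) * ((L : ℝ) ^ i.kk)⁻¹)))))) =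
      (σ * (c35 * (L : ℝ) ^ i.m * α₀) * JJ + 2 * (R₁ * (20 + 4 * (Λ * cΦ * (c35 * (L : ℝ) ^ i.m * α₀))))) * ((L : ℝ) ^ i.kk)⁻¹ := by
    show _ = (σ * (c35 * (L : ℝ) ^ i.m * α₀) * (1 + Fintype.card (Fin (d + 1) ⊕ Fin (d + 1))) + 2 * (R₁ * (20 + 4 * ((Fintype.card ι * (@basisConst ι _ (Matrix mm mm ℂ) Matrix.frobeniusNormedAddCommGroup Matrix.frobeniusNormedSpace e * (2 * Real.sqrt (Fintype.card mm)) * Real.sqrt (Fintype.card mm))) * (3 ^ (d + 1) * (72 * ((d : ℝ) + 1) ^ 2 + 9 * ((d : ℝ) + 1)) + (2 + 2 * Real.exp 1 + 2 * Real.exp 1 ^ 2 * ((d : ℝ) + 1))) * (c35 * (L : ℝ) ^ i.m * α₀))))) * ((L : ℝ) ^ i.kk)⁻¹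
    ring
  have hC₁le : σ * (c35 * (L : ℝ) ^ i.m * α₀) * JJ + 2 * (R₁ * (20 + 4 * (Λ * cΦ * (c35 * (L : ℝ) ^ i.m * α₀)))) ≤ C₁ := by
    show σ * (c35 * (L : ℝ) ^ i.m * α₀) * JJ + 2 * (R₁ * (20 + 4 * (Λ * cΦ * (c35 * (L : ℝ) ^ i.m * α₀)))) ≤ σ * (c35 * a₀) * JJ + 2 * (R₁ * (20 + 4 * (Λ * cΦ * (c35 * a₀))))
    have h4 : Λ * cΦ * (c35 * (L : ℝ) ^ i.m * α₀) ≤ Λ * cΦ * (c35 * a₀) := mul_le_mul_of_nonneg_left hrAa (mul_nonneg hΛ0 hcΦ0)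
    have h5 : R₁ * (20 + 4 * (Λ * cΦ * (c35 * (L : ℝ) ^ i.m * α₀))) ≤ R₁ * (20 + 4 * (Λ * cΦ * (c35 * a₀))) := mul_le_mul_of_nonneg_left (by linarith) hR₁.le
    linarith [mul_le_mul_of_nonneg_right hSle hJJ0, h5]
  have hbr : ((L : ℝ) ^ i.kk) ^ (-(1 / 16 : ℝ)) + (σ * (c35 * (L : ℝ) ^ i.m * α₀) * (1 + Fintype.card (Fin (d + 1) ⊕ Fin (d + 1))) * ((L : ℝ) ^ i.kk)⁻¹ + 2 * (R₁ * (20 * ((L : ℝ) ^ i.kk)⁻¹ + 4 * Fintype.card ι * (@basisConst ι _ (Matrix mm mm ℂ) Matrix.frobeniusNormedAddCommGroup Matrix.frobeniusNormedSpace e * (2 * Real.sqrt (Fintype.card mm)) * (Real.sqrt (Fintype.card mm) * ((3 ^ (d + 1) * (72 * ((d : ℝ) + 1) ^ 2 + 9 * ((d : ℝ) + 1)) + (2 + 2 * Real.exp 1 + 2 * Real.exp 1 ^ 2 * ((d : ℝ) + 1))) * ((c35 * (L : ℝ) ^ i.m * α₀) * ((L : ℝ) ^ i.kk)⁻¹)))))))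 ≤
      (1 + C₁) * ((L : ℝ) ^ i.kk) ^ (-(1 / 16 : ℝ)) := by
    rw [hre]
    have hA : ((L : ℝ) ^ i.kk) ^ (-(1 / 16 : ℝ)) ≤ ((L : ℝ) ^ i.kk) ^ (-(1 / 16 : ℝ)) := hrfγ
    have hco0 : 0 ≤ σ * (c35 * (L : ℝ) ^ i.m * α₀) * JJ + 2 * (R₁ * (20 + 4 * (Λ * cΦ * (c35 * (L : ℝ) ^ i.m * α₀)))) := by positivity
    have hB : (σ * (c35 * (L : ℝ) ^ i.m * α₀) * JJ + 2 * (R₁ * (20 + 4 * (Λ * cΦ * (c35 * (L : ℝ) ^ i.m * α₀))))) * ((L : ℝ) ^ i.kk)⁻¹ ≤ C₁ * ((L : ℝ) ^ i.kk) ^ (-(1 / 16 : ℝ)) :=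
      mul_le_mul hC₁le (hinv.trans hrfγ) (by positivity) hC₁0
    calc _ ≤ ((L : ℝ) ^ i.kk) ^ (-(1 / 16 : ℝ)) + C₁ * ((L : ℝ) ^ i.kk) ^ (-(1 / 16 : ℝ)) := add_le_add hA hB
      _ = (1 + C₁) * ((L : ℝ) ^ i.kk) ^ (-(1 / 16 : ℝ)) := by ring
  have hrpos : 0 ≤ ((L : ℝ) ^ i.kk) ^ (-(1 / 16 : ℝ)) := Real.rpow_nonneg hxpos.le _
  calc D * (((L : ℝ) ^ i.kk) ^ (-(1 / 16 : ℝ)) + ((14 * Real.exp 1 * (1 + Fintype.card (Fin (d + 1))) * basisConst e * ((1 + Fintype.card (Fin (d + 1))) * ((3 + 2 * ((d : ℝ) + 1)) * (c35 * (L : ℝ) ^ i.m * α₀)))) * (1 + Fintype.card (Fin (d + 1) ⊕ Fin (d + 1))) * ((L : ℝ) ^ i.kk)⁻¹ + 2 * (R₁ * (20 * ((L : ℝ) ^ i.kk)⁻¹ + 4 * Fintype.card ι * (@basisConst ι _ (Matrix mm mm ℂ) Matrix.frobeniusNormedAddCommGroup Matrix.frobeniusNormedSpace e * (2 * Real.sqrt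 (Fintype.card mm)) * (Real.sqrt (Fintype.card mm) * ((3 ^ (d + 1) * (72 * ((d : ℝ) + 1) ^ 2 + 9 * ((d : ℝ) + 1)) + (2 + 2 * Real.exp 1 + 2 * Real.exp 1 ^ 2 * ((d : ℝ) + 1))) * ((c35 * (L : ℝ) ^ i.m * α₀) * ((L : ℝ) ^ i.kk)⁻¹)))))))) * Real.exp (-(δ / 16 * (Literature.MathematicalPhysics.QuantumFieldTheory.Balaban1983to89.B6UnitTorusCarrier.unitTorusGeo L i.kk (cvM d L i.m i.kk hL)).dist y y'))
      ≤ max D 0 * ((1 + C₁) * ((L : ℝ) ^ i.kk) ^ (-(1 / 16 : ℝ))) * Real.exp (-(δ / 16 * (Literature.MathematicalPhysics.QuantumFieldTheory.Balaban1983to89.B6UnitTorusCarrier.unitTorusGeo L i.kk (cvM d L i.m i.kk hL)).dist y y')) := by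
        rw [hscale]
        refine mul_le_mul_of_nonneg_right ?_ hE0
        have hsum0 : 0 ≤ ((L : ℝ) ^ i.kk) ^ (-(1 / 16 : ℝ)) + (σ * (c35 * (L : ℝ) ^ i.m * α₀) * (1 + Fintype.card (Fin (d + 1) ⊕ Fin (d + 1))) * ((L : ℝ) ^ i.kk)⁻¹ + 2 * (R₁ * (20 * ((L : ℝ) ^ i.kk)⁻¹ + 4 * Fintype.card ι * (@basisConst ι _ (Matrix mm mm ℂ) Matrix.frobeniusNormedAddCommGroup Matrix.frobeniusNormedSpace e * (2 * Real.sqrt (Fintype.card mm)) * (Real.sqrt (Fintype.card mm) * ((3 ^ (d + 1) * (72 * ((d : ℝ) + 1) ^ 2 + 9 * ((d : ℝ) + 1)) + (2 + 2 * Real.exp 1 + 2 * Real.exp 1 ^ 2 * ((d : ℝ) + 1))) * ((c35 * (L : ℝ) ^ i.m * α₀) * ((L : ℝ) ^ i.kk)⁻¹))))))) := by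
          positivity
        exact (mul_le_mul_of_nonneg_right (le_max_left D 0) hsum0).trans (mul_le_mul_of_nonneg_left hbr (le_max_right _ _))
    _ ≤ max D 0 * ((1 + C₁) * ((L : ℝ) ^ i.kk) ^ (-(1 / 16 : ℝ))) * Real.exp (-(δ / 16 * (sfGeo d hL i).dist y y')) := mul_le_mul_of_nonneg_left hexp (by positivity)
    _ = (max D 0 * (1 + C₁)) * Real.exp (-(δ / 16 * (sfGeo d hL i).dist y y')) * ((L : ℝ) ^ i.kk) ^ (-(1 / 16 : ℝ)) := by ring
    _ ≤ B₀ * Real.exp (-(δ / 16 * (sfGeo d hL i).dist y y')) * ((L : ℝ) ^ i.kk) ^ (-(1 / 16 : ℝ)) := by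
        refine mul_le_mul_of_nonneg_right (mul_le_mul_of_nonneg_right ?_ (Real.exp_nonneg _)) hrpos
        show max D 0 * (1 + C₁) ≤ max D 0 * (1 + C₁) + 1
        linarith
end Node

end Summit.QuantumFields.YangMills.BalabanUVNodes.N15.Gluing

end
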